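import Summits.FinalStateConjecture.FinalStateConjecture.Theses.ClusterCompleteness
import Literature.Geometry.Lorentzian.CoordCurvature
import Summits.FinalStateConjecture.FinalStateConjecture.Theorems.ClusterCompletenessOmegaLimitMultiKerrVacuumLimit
import Summits.FinalStateConjecture.FinalStateConjecture.Theorems.ClusterCompletenessOmegaLimitMultiKerrTranslates
import HarnessLib

/-!
# Route ClusterCompleteness · crux `OmegaLimitMultiKerr` (stmt-FinalStateConjecture-17639), line `Sketch` v7,
# child 2 `TameEraRecurs`, stub 4 `stub_rebase` — the DARK LIMITS of a horizon-regular red-shift era inherit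
# the collar inequalities (red-shift, horizon regularity, null inner boundary) pointwise

Support file of the stub-worker audit of `stub_rebase` (wave 3, 2026-08-17; work file `work/stubs/stub_rebase.lean`
of the lead's folder; companion file `…RebaseDarkLimitStationary.lean`). The granted no-hair statement of
`stub_rebase` (v7) consumes, for the limit chart metric `G = g + g_B` of a dark limit `g` of a hole deviation,
a NULL INNER BOUNDARY (`∀ ε ∃ δ`, `|dr(G♯dr)| ≤ ε` on the `δ`-collar) and — as the premise of its v7
sub-extremality conjunct — a NON-DEGENERATE RED-SHIFT (`κ₀ (r − r₊) ≤ dr(G♯dr)` on a collar). The era carries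
these clauses for the chart metric `deviationExtend + g_B` at every chart time `τ > τ₀`; this file passes them
to the dark limit, pointwise on the exterior, in the toolkit's currency (translates `x ↦ h (x + Tₙ • Λe₀)`
converging to `g` in `supCkENorm` on compact subsets of the exterior; invertibility of `g(x) + g_B(x)` is the
output of `…LimitIsMetric`):

* `tendsto_apply_inverse_apply` — `B ↦ α(B⁻¹β)` is continuous at invertible forms (filter form).
* `tendsto_redShift_translate_of_tendsto` — along the orbit `x + Tₙ • Λe₀` the red-shift scalar `dr(G♯dr)` of
  the chart metric converges to that of the limit chart metric at `x` (`dr` and `g_B` are orbit-invariant: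
  `KerrSchildChart.radius_add_smul`, `boostedKerrBilin_add_smul`).
* `eventually_translate_mem_truncTimeSlab` — the translate of a collar point eventually lies on a LATE collar slab.
* `hole_omegaLimit_redShift_le` (`κ₀ (r − r₊) ≤ dr(G♯dr)` passes), `hole_omegaLimit_abs_redShift_le`
  (`|dr(G♯dr)| ≤ κ₁ (r − r₊)` passes), `hole_omegaLimit_nullBoundary` (`∀ ε ∃ δ` passes, in the no-hair input
  form `∀ x ∈ exterior, r(x) < r₊ + δ → …`), and the registered sub-goal `hole_omegaLimit_collar` (the three
  together, hypotheses = the v7 era clauses of `stub_rebase` for one hole verbatim).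

Everything is proved; Mathlib + landed `Literature` / `Theorems` files only; no definitions.
DRSR arXiv:1402.7034, §2.1.1 (the red-shift is read off `g⁻¹(dr, dr)`); Hale 1980, Ch. I §8 (closed
constraints pass to ω-limits); O'Neill 1983, Ch. 3 p. 60 (index raising).
-/

set_option linter.dupNamespace false

noncomputable section

open scoped Manifold ContDiff Topology ENNReal
open Set Filter Function TopologicalSpace

namespace Summit.FinalStateConjecture.FinalStateConjecture.Theorems.ClusterCompleteness

open Literature.Geometry.Lorentzian

/-! ### The collar inequalities (red-shift, horizon regularity, null boundary) pass to dark limits -/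

section Collar

/-- The raised square `α(B⁻¹β)` is continuous in the form `B` at an invertible form `A`, filter form
(inversion of continuous linear maps is continuous at invertible maps). [folklore] -/
theorem tendsto_apply_inverse_apply {ι : Type*} {l : Filter ι} {A : E4 →L[ℝ] E4 →L[ℝ] ℝ}
    (hA : A.IsInvertible) {Bs : ι → E4 →L[ℝ] E4 →L[ℝ] ℝ} (h : Tendsto Bs l (𝓝 A))
    (α β : E4 →L[ℝ] ℝ) :
    Tendsto (fun i ↦ α ((Bs i).inverse β)) l (𝓝 (α (A.inverse β))) := by
  have h1 : ContinuousAt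
      (ContinuousLinearMap.inverse : (E4 →L[ℝ] E4 →L[ℝ] ℝ) → ((E4 →L[ℝ] ℝ) →L[ℝ] E4)) A :=
    (hA.contDiffAt_map_inverse (n := 0)).continuousAt
  have h2 : ContinuousAt (fun B : E4 →L[ℝ] E4 →L[ℝ] ℝ ↦ α (B.inverse β)) A :=
    continuousAt_const.clm_apply (h1.clm_apply continuousAt_const)
  exact h2.tendsto.comp h

variable (𝓢 : Spacetime 4) (Λ : lorentzGroup) (c : E4) (M a : ℝ)

/-- **The red-shift scalar along the Killing orbit converges to the red-shift scalar of the dark limit.**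
Let `g` be an ω-limit of the deviation translates of a hole chart `Ψ` along `T n` (in `supCkENorm` on
compacts of the exterior, any order), `x` a point of the exterior at which the limit chart metric
`g(x) + g_B(x)` is invertible. Then
`dr(G♯dr)(x + Tₙ Λe₀) → dr((g + g_B)♯ dr)(x)` for the chart metric `G = deviationExtend + g_B`: the
differential `dr` of the rest-frame radius and the form `g_B` are invariant along the orbit
(`KerrSchildChart.radius_add_smul`, `boostedKerrBilin_add_smul`), `G(x + Tₙ Λe₀) → g(x) + g_B(x)`
pointwise, and `B ↦ dr(B⁻¹dr)` is continuous at invertible forms. [folklore] -/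
theorem tendsto_redShift_translate_of_tendsto (Ψ : (boostedKerrBackground Λ c M a).domain → 𝓢.carrier)
    {k : ℕ} {g : E4 → E4 →L[ℝ] E4 →L[ℝ] ℝ} {T : ℕ → ℝ}
    (hlim : ∀ K ⊆ (boostedKerrExterior Λ c M a : Set E4), IsCompact K →
      Tendsto (fun n ↦ supCkENorm K k (fun x ↦
        𝓢.deviationExtend (boostedKerrBackground Λ c M a) Ψ
          (x + T n • (Λ : E4 ≃L[ℝ] E4) (E4.basisVector 0)) - g x)) atTop (𝓝 0))
    {x : E4} (hx : x ∈ (boostedKerrExterior Λ c M a : Set E4))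
    (hinv : (g x + boostedKerrBilin Λ c M a x).IsInvertible) :
    Tendsto (fun n ↦
      (fderiv ℝ (fun y ↦ Kerr.radius a (poincareInv Λ c y))
        (x + T n • (Λ : E4 ≃L[ℝ] E4) (E4.basisVector 0)))
        (MetricCoord.sharpAt (fun y ↦ 𝓢.deviationExtend (boostedKerrBackground Λ c M a) Ψ y +
          boostedKerrBilin Λ c M a y) (x + T n • (Λ : E4 ≃L[ℝ] E4) (E4.basisVector 0))
          (fderiv ℝ (fun y ↦ Kerr.radius a (poincareInv Λ c y))
            (x + T n • (Λ : E4 ≃L[ℝ] E4) (E4.basisVector 0))))) atTop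
      (𝓝 ((fderiv ℝ (fun y ↦ Kerr.radius a (poincareInv Λ c y)) x)
        (MetricCoord.sharpAt (fun y ↦ g y + boostedKerrBilin Λ c M a y) x
          (fderiv ℝ (fun y ↦ Kerr.radius a (poincareInv Λ c y)) x)))) := by
  -- `dr` is invariant along the orbit
  have hα : ∀ n, fderiv ℝ (fun y ↦ Kerr.radius a (poincareInv Λ c y)) (x + T n • (Λ : E4 ≃L[ℝ] E4) (E4.basisVector 0)) =
      fderiv ℝ (fun y ↦ Kerr.radius a (poincareInv Λ c y)) x := by
    intro n
    rw [← fderiv_comp_add_right (T n • (Λ : E4 ≃L[ℝ] E4) (E4.basisVector 0))]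
    congr 1
    funext y
    exact KerrSchildChart.radius_add_smul Λ c M a y (T n)
  -- the chart metric along the orbit converges to the limit chart metric at `x`
  -- (sums of limits are taken in the `supCkENorm` currency: the strong topology of the form space has no
  -- `ContinuousAdd` instance syntactically matching `ContinuousLinearMap.add`)
  have hlim' : Tendsto (fun n ↦ supCkENorm ({x} : Set E4) k (fun y ↦
      (𝓢.deviationExtend (boostedKerrBackground Λ c M a) Ψ (y + T n • (Λ : E4 ≃L[ℝ] E4) (E4.basisVector 0)) +
        boostedKerrBilin Λ c M a y) - (g y + boostedKerrBilin Λ c M a y))) atTop (𝓝 0) := by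
    refine (hlim {x} (singleton_subset_iff.2 hx) isCompact_singleton).congr fun n ↦ ?_
    congr 1
    funext y
    abel
  have h0 : Tendsto (fun n ↦ 𝓢.deviationExtend (boostedKerrBackground Λ c M a) Ψ
      (x + T n • (Λ : E4 ≃L[ℝ] E4) (E4.basisVector 0)) + boostedKerrBilin Λ c M a x) atTop
      (𝓝 (g x + boostedKerrBilin Λ c M a x)) :=
    tendsto_of_tendsto_supCkENorm_sub
      (f := fun n y ↦ 𝓢.deviationExtend (boostedKerrBackground Λ c M a) Ψ
        (y + T n • (Λ : E4 ≃L[ℝ] E4) (E4.basisVector 0)) + boostedKerrBilin Λ c M a y)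
      (g := fun y ↦ g y + boostedKerrBilin Λ c M a y) (mem_singleton x) hlim'
  have h1 : Tendsto (fun n ↦ 𝓢.deviationExtend (boostedKerrBackground Λ c M a) Ψ
      (x + T n • (Λ : E4 ≃L[ℝ] E4) (E4.basisVector 0)) +
      boostedKerrBilin Λ c M a (x + T n • (Λ : E4 ≃L[ℝ] E4) (E4.basisVector 0))) atTop
      (𝓝 (g x + boostedKerrBilin Λ c M a x)) := by
    refine h0.congr fun n ↦ ?_
    rw [KerrSchildChart.boostedKerrBilin_add_smul Λ c M a x (T n)]
  have h2 := tendsto_apply_inverse_apply hinv h1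
    (fderiv ℝ (fun y ↦ Kerr.radius a (poincareInv Λ c y)) x)
    (fderiv ℝ (fun y ↦ Kerr.radius a (poincareInv Λ c y)) x)
  refine h2.congr fun n ↦ ?_
  simp only [MetricCoord.sharpAt, hα n]

/-- Eventually along `T n → +∞` the translate `x + Tₙ Λe₀` of a point `x` of the exterior with `r(x) ≤ R` lies
on a LATE truncated slab: `t*(x) + Tₙ > τ₀` and `x + Tₙ Λe₀ ∈ {t* = t*(x) + Tₙ, r ≤ R}`
(`KerrSchildChart.time_add_smul / radius_add_smul`). [folklore] -/
theorem eventually_translate_mem_truncTimeSlab {T : ℕ → ℝ} (hT : Tendsto T atTop atTop) {x : E4}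
    (hx : x ∈ (boostedKerrExterior Λ c M a : Set E4)) {R : ℝ} (hr : Kerr.radius a (poincareInv Λ c x) ≤ R)
    (τ₀ : ℝ) :
    ∀ᶠ n in atTop, τ₀ < (boostedKerrBackground Λ c M a).time x + T n ∧
      (⟨x + T n • (Λ : E4 ≃L[ℝ] E4) (E4.basisVector 0),
          add_smul_mem_boostedKerrBackground_domain Λ c M a x hx (T n)⟩ :
          (boostedKerrBackground Λ c M a).domain) ∈
        (boostedKerrBackground Λ c M a).truncTimeSlab R ((boostedKerrBackground Λ c M a).time x + T n) := by
  have hτ : Tendsto (fun n ↦ (boostedKerrBackground Λ c M a).time x + T n) atTop atTop :=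
    tendsto_atTop_add_const_left _ _ hT
  refine (hτ.eventually_gt_atTop τ₀).mono fun n hn ↦ ⟨hn, ?_⟩
  rw [ModelBackground.mem_truncTimeSlab]
  exact ⟨KerrSchildChart.time_add_smul Λ c M a x (T n),
    (KerrSchildChart.radius_add_smul Λ c M a x (T n)).le.trans hr⟩

/-- **The era's red-shift bound passes to the dark limit.** If the hole chart `Ψ` has uniform red-shift
on a `δ`-collar at all chart times `τ > τ₀` — `κ₀ (r − r₊) ≤ dr(G♯dr)` on `{t* = τ, r ≤ r₊ + δ}`,
`G = deviationExtend + g_B` (the v7 era clause verbatim) — and `g` is an ω-limit of its deviation translates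
along `T n → +∞` whose limit chart metric is invertible at the collar point `x` (`r(x) ≤ r₊ + δ`), then
`κ₀ (r(x) − r₊) ≤ dr((g + g_B)♯dr)(x)`: the premise of the v7 sub-extremality conjunct of the granted
no-hair statement, for the dark limit. DRSR arXiv:1402.7034, §2.1.1 (surface gravity / red-shift is read
off `g⁻¹(dr, dr)`). [folklore] -/
theorem hole_omegaLimit_redShift_le (Ψ : (boostedKerrBackground Λ c M a).domain → 𝓢.carrier)
    {τ₀ κ₀ δ : ℝ}
    (hRS : ∀ τ : ℝ, τ₀ < τ → ∀ x ∈ (boostedKerrBackground Λ c M a).truncTimeSlab (Kerr.rPlus M a + δ) τ,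
      κ₀ * ((boostedKerrBackground Λ c M a).radius x.1 - Kerr.rPlus M a) ≤
        (fderiv ℝ (fun y ↦ Kerr.radius a (poincareInv Λ c y)) (x : E4))
          (MetricCoord.sharpAt (fun y ↦ 𝓢.deviationExtend (boostedKerrBackground Λ c M a) Ψ y +
            boostedKerrBilin Λ c M a y) (x : E4)
            (fderiv ℝ (fun y ↦ Kerr.radius a (poincareInv Λ c y)) (x : E4))))
    {k : ℕ} {g : E4 → E4 →L[ℝ] E4 →L[ℝ] ℝ} {T : ℕ → ℝ} (hT : Tendsto T atTop atTop)
    (hlim : ∀ K ⊆ (boostedKerrExterior Λ c M a : Set E4), IsCompact K →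
      Tendsto (fun n ↦ supCkENorm K k (fun x ↦
        𝓢.deviationExtend (boostedKerrBackground Λ c M a) Ψ
          (x + T n • (Λ : E4 ≃L[ℝ] E4) (E4.basisVector 0)) - g x)) atTop (𝓝 0))
    {x : E4} (hx : x ∈ (boostedKerrExterior Λ c M a : Set E4))
    (hr : Kerr.radius a (poincareInv Λ c x) ≤ Kerr.rPlus M a + δ)
    (hinv : (g x + boostedKerrBilin Λ c M a x).IsInvertible) :
    κ₀ * (Kerr.radius a (poincareInv Λ c x) - Kerr.rPlus M a) ≤
      (fderiv ℝ (fun y ↦ Kerr.radius a (poincareInv Λ c y)) x)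
        (MetricCoord.sharpAt (fun y ↦ g y + boostedKerrBilin Λ c M a y) x
          (fderiv ℝ (fun y ↦ Kerr.radius a (poincareInv Λ c y)) x)) := by
  refine ge_of_tendsto (tendsto_redShift_translate_of_tendsto 𝓢 Λ c M a Ψ hlim hx hinv) ?_
  -- eventually the translate lies on a late collar slab, where the era clause applies
  refine (eventually_translate_mem_truncTimeSlab Λ c M a hT hx hr τ₀).mono fun n hn ↦ ?_
  have h := hRS _ hn.1 _ hn.2
  rw [KerrSchildChart.radius_add_smul] at h
  exact h

/-- **The era's horizon-regularity bound passes to the dark limit**: if `|dr(G♯dr)| ≤ κ₁ (r − r₊)` on the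
`δ₁`-collar at all chart times `τ > τ₀` (the v5–v7 linear collar bound), then the same holds for the limit
chart metric `g + g_B` at every collar point where it is invertible. [folklore] -/
theorem hole_omegaLimit_abs_redShift_le (Ψ : (boostedKerrBackground Λ c M a).domain → 𝓢.carrier)
    {τ₀ κ₁ δ₁ : ℝ}
    (hcollar : ∀ τ : ℝ, τ₀ < τ →
      ∀ x ∈ (boostedKerrBackground Λ c M a).truncTimeSlab (Kerr.rPlus M a + δ₁) τ,
      |((fderiv ℝ (fun y ↦ Kerr.radius a (poincareInv Λ c y)) (x : E4))
          (MetricCoord.sharpAt (fun y ↦ 𝓢.deviationExtend (boostedKerrBackground Λ c M a) Ψ y +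
            boostedKerrBilin Λ c M a y) (x : E4)
            (fderiv ℝ (fun y ↦ Kerr.radius a (poincareInv Λ c y)) (x : E4))))| ≤
        κ₁ * ((boostedKerrBackground Λ c M a).radius (x : E4) - Kerr.rPlus M a))
    {k : ℕ} {g : E4 → E4 →L[ℝ] E4 →L[ℝ] ℝ} {T : ℕ → ℝ} (hT : Tendsto T atTop atTop)
    (hlim : ∀ K ⊆ (boostedKerrExterior Λ c M a : Set E4), IsCompact K →
      Tendsto (fun n ↦ supCkENorm K k (fun x ↦
        𝓢.deviationExtend (boostedKerrBackground Λ c M a) Ψ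
          (x + T n • (Λ : E4 ≃L[ℝ] E4) (E4.basisVector 0)) - g x)) atTop (𝓝 0))
    {x : E4} (hx : x ∈ (boostedKerrExterior Λ c M a : Set E4))
    (hr : Kerr.radius a (poincareInv Λ c x) ≤ Kerr.rPlus M a + δ₁)
    (hinv : (g x + boostedKerrBilin Λ c M a x).IsInvertible) :
    |((fderiv ℝ (fun y ↦ Kerr.radius a (poincareInv Λ c y)) x)
        (MetricCoord.sharpAt (fun y ↦ g y + boostedKerrBilin Λ c M a y) x
          (fderiv ℝ (fun y ↦ Kerr.radius a (poincareInv Λ c y)) x)))| ≤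
      κ₁ * (Kerr.radius a (poincareInv Λ c x) - Kerr.rPlus M a) := by
  refine le_of_tendsto ((continuous_abs.tendsto _).comp
    (tendsto_redShift_translate_of_tendsto 𝓢 Λ c M a Ψ hlim hx hinv)) ?_
  refine (eventually_translate_mem_truncTimeSlab Λ c M a hT hx hr τ₀).mono fun n hn ↦ ?_
  have h := hcollar _ hn.1 _ hn.2
  rw [KerrSchildChart.radius_add_smul] at h
  exact h

/-- **The era's null inner boundary passes to the dark limit**: if for every `ε > 0` there is `δ > 0`
with `|dr(G♯dr)| ≤ ε` on the `δ`-collar at all chart times `τ > τ₀` (the conclusion of the landed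
`stub_eraHorizonNull`), then the limit chart metric `g + g_B` has a null inner boundary in the form the
granted no-hair statement consumes: `∀ ε > 0 ∃ δ > 0 ∀ x ∈ exterior, r(x) < r₊ + δ → |dr((g+g_B)♯dr)(x)| ≤ ε`,
granted invertibility of the limit chart metric on the exterior. [folklore] -/
theorem hole_omegaLimit_nullBoundary (Ψ : (boostedKerrBackground Λ c M a).domain → 𝓢.carrier) {τ₀ : ℝ}
    (hnull : ∀ ε : ℝ, 0 < ε → ∃ δ : ℝ, 0 < δ ∧ ∀ τ : ℝ, τ₀ < τ →
      ∀ x ∈ (boostedKerrBackground Λ c M a).truncTimeSlab (Kerr.rPlus M a + δ) τ,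
      |((fderiv ℝ (fun y ↦ Kerr.radius a (poincareInv Λ c y)) (x : E4))
          (MetricCoord.sharpAt (fun y ↦ 𝓢.deviationExtend (boostedKerrBackground Λ c M a) Ψ y +
            boostedKerrBilin Λ c M a y) (x : E4)
            (fderiv ℝ (fun y ↦ Kerr.radius a (poincareInv Λ c y)) (x : E4))))| ≤ ε)
    {k : ℕ} {g : E4 → E4 →L[ℝ] E4 →L[ℝ] ℝ} {T : ℕ → ℝ} (hT : Tendsto T atTop atTop)
    (hlim : ∀ K ⊆ (boostedKerrExterior Λ c M a : Set E4), IsCompact K →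
      Tendsto (fun n ↦ supCkENorm K k (fun x ↦
        𝓢.deviationExtend (boostedKerrBackground Λ c M a) Ψ
          (x + T n • (Λ : E4 ≃L[ℝ] E4) (E4.basisVector 0)) - g x)) atTop (𝓝 0))
    (hinv : ∀ x ∈ (boostedKerrExterior Λ c M a : Set E4), (g x + boostedKerrBilin Λ c M a x).IsInvertible) :
    ∀ ε : ℝ, 0 < ε → ∃ δ : ℝ, 0 < δ ∧ ∀ x ∈ (boostedKerrExterior Λ c M a : Set E4),
      Kerr.radius a (poincareInv Λ c x) < Kerr.rPlus M a + δ →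
      |((fderiv ℝ (fun y ↦ Kerr.radius a (poincareInv Λ c y)) x)
          (MetricCoord.sharpAt (fun y ↦ g y + boostedKerrBilin Λ c M a y) x
            (fderiv ℝ (fun y ↦ Kerr.radius a (poincareInv Λ c y)) x)))| ≤ ε := by
  intro ε hε
  obtain ⟨δ, hδ, h⟩ := hnull ε hε
  refine ⟨δ, hδ, fun x hx hr ↦ ?_⟩
  refine le_of_tendsto ((continuous_abs.tendsto _).comp
    (tendsto_redShift_translate_of_tendsto 𝓢 Λ c M a Ψ hlim hx (hinv x hx))) ?_
  refine (eventually_translate_mem_truncTimeSlab Λ c M a hT hx hr.le τ₀).mono fun n hn ↦ ?_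
  exact h _ hn.1 _ hn.2

/-- **Registered sub-goal: the dark limit of a horizon-regular red-shift hole chart with null inner boundary
inherits all three collar clauses.** Hypotheses: the v7 era clauses of `stub_rebase` for ONE hole, verbatim
(linear collar bound `|dr(G♯dr)| ≤ κ₁ (r − r₊)` on the `δ₁`-collar, red-shift `κ₀ (r − r₊) ≤ dr(G♯dr)` on the
`δ`-collar, null inner boundary `∀ ε ∃ δ'`, all at every chart time `τ > τ₀`), an ω-limit `g` of the deviation
translates along `T n → +∞`, and invertibility of the limit chart metric `g + g_B` on the exterior. Conclusion:
the same three clauses for `g + g_B`, pointwise on the exterior (the last in the no-hair input form). [folklore] -/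
theorem hole_omegaLimit_collar :
  ∀ (𝓢 : Spacetime.{0} 4) (Λ : lorentzGroup) (c : E4) (M a : ℝ) (Ψ : (boostedKerrBackground Λ c M a).domain → 𝓢.carrier) (τ₀ κ₁ δ₁ κ₀ δ : ℝ), (∀ τ : ℝ, τ₀ < τ → ∀ x ∈ (boostedKerrBackground Λ c M a).truncTimeSlab (Kerr.rPlus M a + δ₁) τ, |((fderiv ℝ (fun y ↦ Kerr.radius a (poincareInv Λ c y)) (x : E4)) (MetricCoord.sharpAt (fun y ↦ 𝓢.deviationExtend (boostedKerrBackground Λ c M a) Ψ y + boostedKerrBilin Λ c M a y) (x : E4) (fderiv ℝ (fun y ↦ Kerr.radius a (poincareInv Λ c y)) (x : E4))))| ≤ κ₁ * ((boostedKerrBackground Λ c M a).radius (x : E4) - Kerr.rPlus M a)) → (∀ τ : ℝ, τ₀ < τ → ∀ x ∈ (boostedKerrBackground Λ c M a).truncTimeSlab (Kerr.rPlus M a + δ) τ, κ₀ * ((boostedKerrBackground Λ c M a).radius x.1 - Kerr.rPlus M a) ≤ (fderiv ℝ (fun y ↦ Kerr.radius a (poincareInv Λ c y)) (x : E4)) (MetricCoord.sharpAt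 (fun y ↦ 𝓢.deviationExtend (boostedKerrBackground Λ c M a) Ψ y + boostedKerrBilin Λ c M a y) (x : E4) (fderiv ℝ (fun y ↦ Kerr.radius a (poincareInv Λ c y)) (x : E4)))) → (∀ ε : ℝ, 0 < ε → ∃ δ' : ℝ, 0 < δ' ∧ ∀ τ : ℝ, τ₀ < τ → ∀ x ∈ (boostedKerrBackground Λ c M a).truncTimeSlab (Kerr.rPlus M a + δ') τ, |((fderiv ℝ (fun y ↦ Kerr.radius a (poincareInv Λ c y)) (x : E4)) (MetricCoord.sharpAt (fun y ↦ 𝓢.deviationExtend (boostedKerrBackground Λ c M a) Ψ y + boostedKerrBilin Λ c M a y) (x : E4) (fderiv ℝ (fun y ↦ Kerr.radius a (poincareInv Λ c y)) (x : E4))))| ≤ ε) → ∀ (k : ℕ) (g : E4 → E4 →L[ℝ] E4 →L[ℝ] ℝ) (T : ℕ → ℝ), Tendsto T atTop atTop → (∀ K ⊆ (boostedKerrExterior Λ c M a : Set E4), IsCompact K → Tendsto (fun n ↦ supCkENorm K k (fun x ↦ 𝓢.deviationExtend (boostedKerrBackground Λ c M a) Ψ (x + T n • (Λ : E4 ≃L[ℝ]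 E4) (E4.basisVector 0)) - g x)) atTop (𝓝 0)) → (∀ x ∈ (boostedKerrExterior Λ c M a : Set E4), (g x + boostedKerrBilin Λ c M a x).IsInvertible) → (∀ x ∈ (boostedKerrExterior Λ c M a : Set E4), Kerr.radius a (poincareInv Λ c x) ≤ Kerr.rPlus M a + δ₁ → |((fderiv ℝ (fun y ↦ Kerr.radius a (poincareInv Λ c y)) x) (MetricCoord.sharpAt (fun y ↦ g y + boostedKerrBilin Λ c M a y) x (fderiv ℝ (fun y ↦ Kerr.radius a (poincareInv Λ c y)) x)))| ≤ κ₁ * (Kerr.radius a (poincareInv Λ c x) - Kerr.rPlus M a)) ∧ (∀ x ∈ (boostedKerrExterior Λ c M a : Set E4), Kerr.radius a (poincareInv Λ c x) ≤ Kerr.rPlus M a + δ → κ₀ * (Kerr.radius a (poincareInv Λ c x) - Kerr.rPlus M a) ≤ (fderiv ℝ (fun y ↦ Kerr.radius a (poincareInv Λ c y)) x) (MetricCoord.sharpAt (fun y ↦ g y + boostedKerrBilin Λ c M a y) x (fderiv ℝ (fun y ↦ Kerr.radius a (poincareInv Λ c y)) x))) ∧ (∀ ε : ℝ, 0 < ε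 → ∃ δ' : ℝ, 0 < δ' ∧ ∀ x ∈ (boostedKerrExterior Λ c M a : Set E4), Kerr.radius a (poincareInv Λ c x) < Kerr.rPlus M a + δ' → |((fderiv ℝ (fun y ↦ Kerr.radius a (poincareInv Λ c y)) x) (MetricCoord.sharpAt (fun y ↦ g y + boostedKerrBilin Λ c M a y) x (fderiv ℝ (fun y ↦ Kerr.radius a (poincareInv Λ c y)) x)))| ≤ ε) :=
  fun 𝓢 Λ c M a Ψ _ _ _ _ _ hcollar hRS hnull _ _ _ hT hlim hinv ↦
  ⟨fun _ hx hr ↦ hole_omegaLimit_abs_redShift_le 𝓢 Λ c M a Ψ hcollar hT hlim hx hr (hinv _ hx),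
    fun _ hx hr ↦ hole_omegaLimit_redShift_le 𝓢 Λ c M a Ψ hRS hT hlim hx hr (hinv _ hx),
    hole_omegaLimit_nullBoundary 𝓢 Λ c M a Ψ hnull hT hlim hinv⟩

end Collar

end Summit.FinalStateConjecture.FinalStateConjecture.Theorems.ClusterCompleteness

end
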